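import Mathlib
import HarnessLib
import Summits.Ventures.LatticeQCDFlow.Scoring.UStatisticProjectionsIntegral

/-!
# LatticeQCDFlow / Scoring — Hoeffding's variance law for an order-2 U-statistic on the PRODUCT
# SPACE `(Fin n → X, ν^{⊗n})`: the `Measure.pi` corollaries

HONEST FRAMING: exact (Metropolis-corrected) sampling algorithms for lattice gauge theory;
figures of merit are autocorrelation/cost numbers at stated couplings and volumes; no
continuum-physics claim.

Venture `LatticeQCDFlow` (cell pub-lqcd), sub-topic `Scoring`; FANOUT row 3 (`s0-u1-a`, S0-B
implementation A, GEN-10).  Bookkeeping [folklore]: row 3's general-space Hoeffding law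
(`Scoring/UStatisticVarianceIntegral`) and sandwich (`Scoring/UStatisticProjectionsIntegral`,
imported) are stated for an abstract probability space and a family `x_i : Ω → X` that is
`iIndepFun` with common law `ν`; this file records the canonical realisation — the coordinates of
the product probability space `(Fin n → X, Measure.pi (fun _ ↦ ν))`, the measure-theoretic
counterpart of the finite `blockProd (fun _ ↦ q)` of row 3's GEN-8 files and the setting of the
cell's `Measure.pi`-based files (row 7's Efron–Stein / lattice files) — so that the law can be
quoted there without the independence bookkeeping (Mathlib's `iIndepFun_pi`,
`measurePreserving_eval`).  NO definition is introduced.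

* `iIndepFun_eval_pi`, `map_eval_pi` — the coordinates are independent with law `ν`;
* `integral_ustat₂_pi` (`E U = μ_F`), **`variance_ustat₂_eq_pi`** / **`variance_ustat₂_pi`** —
  `E[(U − μ_F)²] = Var[U] = (2(c₂ − μ_F²) + 4(n − 2)(c₁ − μ_F²))/(n(n − 1))` under `ν^{⊗n}`,
  `variance_ustat₂_le_pi` / `le_variance_ustat₂_pi` (the sandwich `4ζ₁/n ≤ · ≤ 2ζ₂/n`) and
  `chebyshev_ustat₂_pi`.

NOT CLAIMED: anything beyond the specialisation.
-/

namespace Summit.Ventures.LatticeQCDFlow.Scoring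

open MeasureTheory ProbabilityTheory Finset

section Pi

variable {X : Type*} [MeasurableSpace X] {ν : Measure X} [IsProbabilityMeasure ν] {n : ℕ}

/-- The coordinates of `(Fin n → X, ν^{⊗n})` are measurable. [folklore] -/
theorem measurable_eval_pi (i : Fin n) : Measurable fun φ : Fin n → X => φ i :=
  measurable_pi_apply i

/-- **The coordinates of `(Fin n → X, ν^{⊗n})` are mutually independent** (Mathlib's
`iIndepFun_pi`). [folklore] -/
theorem iIndepFun_eval_pi :
    iIndepFun (fun (i : Fin n) (φ : Fin n → X) => φ i) (Measure.pi fun _ : Fin n => ν) :=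
  iIndepFun_pi (X := fun _ : Fin n => @id X) fun _ => aemeasurable_id

/-- **Each coordinate of `(Fin n → X, ν^{⊗n})` has law `ν`** (Mathlib's `measurePreserving_eval`).
[folklore] -/
theorem map_eval_pi (i : Fin n) :
    Measure.map (fun φ : Fin n → X => φ i) (Measure.pi fun _ : Fin n => ν) = ν :=
  (measurePreserving_eval (fun _ : Fin n => ν) i).map_eq

/-- **`E U = μ_F` under `ν^{⊗n}`** (`n ≥ 2`). [folklore] -/
theorem integral_ustat₂_pi {F : X → X → ℝ} (hFm : Measurable fun z : X × X => F z.1 z.2)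
    (hF2 : MemLp (fun z : X × X => F z.1 z.2) 2 (ν.prod ν)) (hn : 2 ≤ n) :
    ∫ φ, (∑ z ∈ (univ : Finset (Fin n)).offDiag, F (φ z.1) (φ z.2)) / (n * (n - 1))
        ∂(Measure.pi fun _ : Fin n => ν)
      = ∫ z, F z.1 z.2 ∂(ν.prod ν) :=
  integral_ustat₂_iid (x := fun (i : Fin n) (φ : Fin n → X) => φ i) measurable_eval_pi
    iIndepFun_eval_pi map_eval_pi hFm hF2 hn

/-- **Hoeffding's law under `ν^{⊗n}`, centred second moment**: for `n ≥ 2` and a symmetric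
kernel `F ∈ L²(ν ⊗ ν)`,
`E[(U − μ_F)²] = (2(c₂ − μ_F²) + 4(n − 2)(c₁ − μ_F²))/(n(n − 1))`. [folklore] -/
theorem variance_ustat₂_eq_pi {F : X → X → ℝ} (hFm : Measurable fun z : X × X => F z.1 z.2)
    (hF : ∀ a b, F a b = F b a) (hF2 : MemLp (fun z : X × X => F z.1 z.2) 2 (ν.prod ν))
    (hn : 2 ≤ n) :
    ∫ φ, ((∑ z ∈ (univ : Finset (Fin n)).offDiag, F (φ z.1) (φ z.2)) / (n * (n - 1))
        - ∫ z, F z.1 z.2 ∂(ν.prod ν)) ^ 2 ∂(Measure.pi fun _ : Fin n => ν)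
      = (2 * ((∫ z, F z.1 z.2 ^ 2 ∂(ν.prod ν)) - (∫ z, F z.1 z.2 ∂(ν.prod ν)) ^ 2)
          + 4 * (n - 2) * ((∫ a, (∫ b, F a b ∂ν) ^ 2 ∂ν) - (∫ z, F z.1 z.2 ∂(ν.prod ν)) ^ 2))
        / (n * (n - 1)) :=
  variance_ustat₂_eq_iid (x := fun (i : Fin n) (φ : Fin n → X) => φ i) measurable_eval_pi
    iIndepFun_eval_pi map_eval_pi hFm hF hF2 hn

/-- **Hoeffding's law under `ν^{⊗n}`, `Var[·]` form.** [folklore] -/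
theorem variance_ustat₂_pi {F : X → X → ℝ} (hFm : Measurable fun z : X × X => F z.1 z.2)
    (hF : ∀ a b, F a b = F b a) (hF2 : MemLp (fun z : X × X => F z.1 z.2) 2 (ν.prod ν))
    (hn : 2 ≤ n) :
    Var[fun φ : Fin n → X =>
        (∑ z ∈ (univ : Finset (Fin n)).offDiag, F (φ z.1) (φ z.2)) / (n * (n - 1) : ℝ);
      Measure.pi fun _ : Fin n => ν]
      = (2 * ((∫ z, F z.1 z.2 ^ 2 ∂(ν.prod ν)) - (∫ z, F z.1 z.2 ∂(ν.prod ν)) ^ 2)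
          + 4 * (n - 2) * ((∫ a, (∫ b, F a b ∂ν) ^ 2 ∂ν) - (∫ z, F z.1 z.2 ∂(ν.prod ν)) ^ 2))
        / (n * (n - 1)) :=
  variance_ustat₂_iid (x := fun (i : Fin n) (φ : Fin n → X) => φ i) measurable_eval_pi
    iIndepFun_eval_pi map_eval_pi hFm hF hF2 hn

/-- **Sandwich under `ν^{⊗n}`, upper half**: `E[(U − μ_F)²] ≤ 2ζ₂/n`. [folklore] -/
theorem variance_ustat₂_le_pi {F : X → X → ℝ} (hFm : Measurable fun z : X × X => F z.1 z.2)
    (hF : ∀ a b, F a b = F b a) (hF2 : MemLp (fun z : X × X => F z.1 z.2) 2 (ν.prod ν))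
    (hn : 2 ≤ n) :
    ∫ φ, ((∑ z ∈ (univ : Finset (Fin n)).offDiag, F (φ z.1) (φ z.2)) / (n * (n - 1))
        - ∫ z, F z.1 z.2 ∂(ν.prod ν)) ^ 2 ∂(Measure.pi fun _ : Fin n => ν)
      ≤ 2 * ((∫ z, F z.1 z.2 ^ 2 ∂(ν.prod ν)) - (∫ z, F z.1 z.2 ∂(ν.prod ν)) ^ 2) / n :=
  variance_ustat₂_le_iid (x := fun (i : Fin n) (φ : Fin n → X) => φ i) measurable_eval_pi
    iIndepFun_eval_pi map_eval_pi hFm hF hF2 hn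

/-- **Sandwich under `ν^{⊗n}`, lower half**: `4ζ₁/n ≤ E[(U − μ_F)²]`. [folklore] -/
theorem le_variance_ustat₂_pi {F : X → X → ℝ} (hFm : Measurable fun z : X × X => F z.1 z.2)
    (hF : ∀ a b, F a b = F b a) (hF2 : MemLp (fun z : X × X => F z.1 z.2) 2 (ν.prod ν))
    (hn : 2 ≤ n) :
    4 * ((∫ a, (∫ b, F a b ∂ν) ^ 2 ∂ν) - (∫ z, F z.1 z.2 ∂(ν.prod ν)) ^ 2) / n
      ≤ ∫ φ, ((∑ z ∈ (univ : Finset (Fin n)).offDiag, F (φ z.1) (φ z.2)) / (n * (n - 1))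
        - ∫ z, F z.1 z.2 ∂(ν.prod ν)) ^ 2 ∂(Measure.pi fun _ : Fin n => ν) :=
  le_variance_ustat₂_iid (x := fun (i : Fin n) (φ : Fin n → X) => φ i) measurable_eval_pi
    iIndepFun_eval_pi map_eval_pi hFm hF hF2 hn

/-- **Chebyshev under `ν^{⊗n}`** with the exact variance: for `n ≥ 2`, `t > 0`,
`ν^{⊗n}(|U − μ_F| ≥ t) ≤ (2(c₂ − μ_F²) + 4(n − 2)(c₁ − μ_F²))/(n(n − 1)t²)`. [folklore] -/
theorem chebyshev_ustat₂_pi {F : X → X → ℝ} (hFm : Measurable fun z : X × X => F z.1 z.2)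
    (hF : ∀ a b, F a b = F b a) (hF2 : MemLp (fun z : X × X => F z.1 z.2) 2 (ν.prod ν))
    (hn : 2 ≤ n) {t : ℝ} (ht : 0 < t) :
    (Measure.pi fun _ : Fin n => ν) {φ : Fin n → X | t ≤
        |(∑ z ∈ (univ : Finset (Fin n)).offDiag, F (φ z.1) (φ z.2)) / (n * (n - 1))
          - ∫ z, F z.1 z.2 ∂(ν.prod ν)|}
      ≤ ENNReal.ofReal
        ((2 * ((∫ z, F z.1 z.2 ^ 2 ∂(ν.prod ν)) - (∫ z, F z.1 z.2 ∂(ν.prod ν)) ^ 2)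
          + 4 * (n - 2) * ((∫ a, (∫ b, F a b ∂ν) ^ 2 ∂ν) - (∫ z, F z.1 z.2 ∂(ν.prod ν)) ^ 2))
        / (n * (n - 1)) / t ^ 2) :=
  chebyshev_ustat₂_iid (x := fun (i : Fin n) (φ : Fin n → X) => φ i) measurable_eval_pi
    iIndepFun_eval_pi map_eval_pi hFm hF hF2 hn ht

end Pi

end Summit.Ventures.LatticeQCDFlow.Scoring
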